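import Literature.NumberTheory.LFunctions.EntireZeroSumWeight
import Literature.NumberTheory.LFunctions.WindowWeight
import HarnessLib

/-!
# The zero sum against a window weight, one entire function

Topic `Literature/NumberTheory/LFunctions`, sub-namespace `EntireEF`. Everything here is PROVED.

The short-interval companion of `EntireZeroSumWeight.lean` (`sum_zeroTerm_le`, the Thorner–Zaman
weight): for an entire `f` (not identically zero) with a window bound `(W, A)` for its non-trivial
zeros, the window weight `g = windowTest a b ε` (`0 < ε < a < b`, `WindowWeight.lean`) with Laplace
transform `F`, `X = e^{b+ε}`, `ℓ = b − a + 2ε` and a height `T₁ ≥ 1`, every finite partial sum of the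
zero terms `Σ m(ρ) ‖F(−ρ)‖` (a finite set `Exc` of excluded zeros allowed) is at most `X` times

  `ℓ · Σ_{|γ| ≤ T₁, β ≥ 1/4, ρ ∉ Exc} m(ρ) X^{β−1} + ℓ · X^{−3/4} Σ_{|γ| ≤ T₁} m(ρ) + (2M/ε) T₁^{−1/2} W (c₁A + c₂)`

(`sum_zeroTerm_window_le`): the FLAT bound `‖F(−ρ)‖ ≤ X^β ℓ` up to height `T₁` (no `1/|γ|`, since
`ℓ ≍ h/x` is already small) and the second-order decay `‖F(−ρ)‖ ≤ X^β (2M/ε)/|ρ|²` beyond, summed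
with the tail lemma `tsum_tail_div_normSq_le`.  Against a log-free zero-density estimate valid up to
height `T₁ = X^{θ}` the first sum is `≪ e^{−c log X/log(QT₁)}` (Bombieri's partial summation,
`LinnikZeroSum.sum_mul_rpow_le_of_density`) — Hoheisel's mechanism.

## References

* G. Hoheisel, *Primzahlprobleme in der Analysis*, S.-B. Preuss. Akad. Wiss. (1930) 580–588. [folklore]
* J. Thorner, A. Zaman, ANT 13 (2019), Lemmas 4.4, 4.5 (the zeros of large height). [ThornerZaman2019]
-/

noncomputable section

open Complex Filter Topology Set Finset

namespace Literature.NumberTheory.LFunctions.EntireEF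

open Literature.NumberTheory.LFunctions.WindowWeight

variable {f : ℂ → ℂ}

/-- `E(−ρ) = X^β = X · X^{β−1}` for the window weight, `X = e^{b+ε}`, `Re ρ ≥ 0`, `a − ε ≤ b + ε`. [folklore] -/
theorem wEdge_neg_eq {a b ε : ℝ} (h : a - ε ≤ b + ε) {ρ : ℂ} (h0 : 0 ≤ ρ.re) :
    wEdge a b ε (-ρ) = Real.exp (b + ε) * Real.exp (b + ε) ^ (ρ.re - 1) := by
  rw [wEdge_eq_of_re_nonpos (by simpa using h0) h]
  have hre : (-ρ).re = -ρ.re := by simp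
  rw [hre, Real.rpow_def_of_pos (Real.exp_pos _), Real.log_exp, ← Real.exp_add]
  congr 1; ring

/-- **The zero terms of one function against a window weight** (see the module docstring).
[cite: ThornerZaman2019, Lemmas 4.4–4.5] -/
theorem sum_zeroTerm_window_le (hf : Differentiable ℂ f) {c : ℂ} (hc : f c ≠ 0) {W A : ℝ} (hW : 0 ≤ W)
    (hA : 0 ≤ A)
    (hwin : ∀ (τ : ℝ) (P : Finset ℂ), (∀ ρ ∈ P, f ρ = 0 ∧ 0 < ρ.re ∧ ρ.re < 1 ∧ |ρ.im - τ| ≤ 1 / 2) →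
      ∑ ρ ∈ P, (analyticOrderNatAt f ρ : ℝ) ≤ W * (A + Real.log (|τ| + 4)))
    {M : ℝ} (hM : ∀ y : ℝ, |iteratedDeriv 1 Real.smoothTransition y| ≤ M ∧ |iteratedDeriv 2 Real.smoothTransition y| ≤ M)
    {a b ε : ℝ} (hε : 0 < ε) (hεa : ε < a) (hab : a < b) {T₁ : ℝ} (hT₁ : 1 ≤ T₁) (Exc : Finset ℂ)
    (u : Finset (nontrivialZeros f)) :
    ∑ ρ ∈ u.filter (fun ρ : nontrivialZeros f ↦ (ρ : ℂ) ∉ Exc),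
        (analyticOrderNatAt f (ρ : ℂ) : ℝ) * ‖fordLaplace (windowTest a b ε) (-(ρ : ℂ))‖ ≤
      Real.exp (b + ε) *
        ((b - a + 2 * ε) * ∑ ρ ∈ (finite_nontrivialZeros_inter hf hc T₁).toFinset with (ρ ∉ Exc ∧ 1 / 4 ≤ ρ.re),
            (analyticOrderNatAt f ρ : ℝ) * Real.exp (b + ε) ^ (ρ.re - 1) +
          (b - a + 2 * ε) * Real.exp (b + ε) ^ (-(3 : ℝ) / 4) *
            ∑ ρ ∈ (finite_nontrivialZeros_inter hf hc T₁).toFinset, (analyticOrderNatAt f ρ : ℝ) +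
          (2 * M / ε) * T₁ ^ (-((1 : ℝ) / 2)) * (W * (tailConst₁ * A + tailConst₂))) := by
  classical
  set X : ℝ := Real.exp (b + ε) with hX
  set ℓ : ℝ := b - a + 2 * ε with hℓ
  have hX0 : 0 < X := Real.exp_pos _
  have hX1 : 1 ≤ X := Real.one_le_exp (by linarith)
  have hℓ0 : 0 ≤ ℓ := by rw [hℓ]; linarith
  have hM0 : 0 ≤ M := le_trans (abs_nonneg _) (hM 0).1
  have hab' : a - ε ≤ b + ε := by linarith
  set m : ℂ → ℝ := fun ρ ↦ (analyticOrderNatAt f ρ : ℝ) with hm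
  have hm0 : ∀ ρ, 0 ≤ m ρ := fun ρ ↦ Nat.cast_nonneg _
  set Fin := (finite_nontrivialZeros_inter hf hc T₁).toFinset with hFin
  have hmemFin : ∀ ρ : ℂ, ρ ∈ Fin ↔ (f ρ = 0 ∧ 0 < ρ.re ∧ ρ.re < 1) ∧ |ρ.im| ≤ T₁ := by
    intro ρ; rw [hFin, Set.Finite.mem_toFinset]; rfl
  -- the edge factor `E(−ρ) = X · X^{β−1}`
  have hE : ∀ ρ : nontrivialZeros f, wEdge a b ε (-(ρ : ℂ)) = X * X ^ ((ρ : ℂ).re - 1) :=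
    fun ρ ↦ wEdge_neg_eq hab' ρ.2.2.1.le
  -- the flat and the second-order bounds for `‖F(−ρ)‖`
  have hF₀ : ∀ ρ : nontrivialZeros f,
      ‖fordLaplace (windowTest a b ε) (-(ρ : ℂ))‖ ≤ X * X ^ ((ρ : ℂ).re - 1) * ℓ := by
    intro ρ
    have h := norm_fordLaplace_windowTest_le₀ (b := b) hε hεa.le hab.le (-(ρ : ℂ))
    rwa [hE ρ] at h
  have hρ0 : ∀ ρ : nontrivialZeros f, (-(ρ : ℂ)) ≠ 0 := fun ρ h ↦ by
    have := ρ.2.2.1; rw [neg_eq_zero] at h; rw [h] at this; simp at this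
  have hF₂ : ∀ ρ : nontrivialZeros f,
      ‖fordLaplace (windowTest a b ε) (-(ρ : ℂ))‖ ≤ X * X ^ ((ρ : ℂ).re - 1) * (2 * M / ε) / ‖(ρ : ℂ)‖ ^ 2 := by
    intro ρ
    have h := (norm_fordLaplace_windowTest_le hM hε hεa hab (hρ0 ρ)).2
    rw [norm_neg, hE ρ] at h
    exact h
  -- split at height `T₁`
  set u₁ := (u.filter fun ρ : nontrivialZeros f ↦ (ρ : ℂ) ∉ Exc).filter
    (fun ρ : nontrivialZeros f ↦ |(ρ : ℂ).im| ≤ T₁) with hu₁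
  set u₂ := (u.filter fun ρ : nontrivialZeros f ↦ (ρ : ℂ) ∉ Exc).filter
    (fun ρ : nontrivialZeros f ↦ ¬ |(ρ : ℂ).im| ≤ T₁) with hu₂
  rw [← Finset.sum_filter_add_sum_filter_not (u.filter fun ρ : nontrivialZeros f ↦ (ρ : ℂ) ∉ Exc)
    (fun ρ : nontrivialZeros f ↦ |(ρ : ℂ).im| ≤ T₁)]
  -- (a) the finite part `|γ| ≤ T₁`
  have hX34 : ∀ {β : ℝ}, β < 1 / 4 → X ^ (β - 1) ≤ X ^ (-(3 : ℝ) / 4) := fun {β} hβ ↦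
    Real.rpow_le_rpow_of_exponent_le hX1 (by linarith)
  have hpart1 : ∑ ρ ∈ u₁, m ρ * ‖fordLaplace (windowTest a b ε) (-(ρ : ℂ))‖ ≤
      X * (ℓ * ∑ ρ ∈ Fin with (ρ ∉ Exc ∧ 1 / 4 ≤ ρ.re), m ρ * X ^ (ρ.re - 1) +
        ℓ * X ^ (-(3 : ℝ) / 4) * ∑ ρ ∈ Fin, m ρ) := by
    have hpt : ∀ ρ ∈ u₁, m ρ * ‖fordLaplace (windowTest a b ε) (-(ρ : ℂ))‖ ≤
        X * (ℓ * (if (1 / 4 : ℝ) ≤ (ρ : ℂ).re then m ρ * X ^ ((ρ : ℂ).re - 1) else 0) +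
          ℓ * X ^ (-(3 : ℝ) / 4) * m ρ) := by
      intro ρ _
      have hmρ := hm0 ρ
      have hbase : m ρ * ‖fordLaplace (windowTest a b ε) (-(ρ : ℂ))‖ ≤ m ρ * (X * X ^ ((ρ : ℂ).re - 1) * ℓ) :=
        mul_le_mul_of_nonneg_left (hF₀ ρ) hmρ
      by_cases hβ : (1 / 4 : ℝ) ≤ (ρ : ℂ).re
      · rw [if_pos hβ]
        have h0 : 0 ≤ X * (ℓ * X ^ (-(3 : ℝ) / 4) * m ρ) := by positivity
        calc m ρ * ‖fordLaplace (windowTest a b ε) (-(ρ : ℂ))‖ ≤ m ρ * (X * X ^ ((ρ : ℂ).re - 1) * ℓ) := hbase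
          _ = X * (ℓ * (m ρ * X ^ ((ρ : ℂ).re - 1))) := by ring
          _ ≤ _ := by nlinarith [h0]
      · rw [if_neg hβ, mul_zero, zero_add]
        rw [not_le] at hβ
        calc m ρ * ‖fordLaplace (windowTest a b ε) (-(ρ : ℂ))‖ ≤ m ρ * (X * X ^ ((ρ : ℂ).re - 1) * ℓ) := hbase
          _ ≤ m ρ * (X * X ^ (-(3 : ℝ) / 4) * ℓ) := by
              refine mul_le_mul_of_nonneg_left ?_ hmρ
              exact mul_le_mul_of_nonneg_right (mul_le_mul_of_nonneg_left (hX34 hβ) hX0.le) hℓ0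
          _ = X * (ℓ * X ^ (-(3 : ℝ) / 4) * m ρ) := by ring
    refine (Finset.sum_le_sum hpt).trans ?_
    rw [← Finset.mul_sum, Finset.sum_add_distrib, ← Finset.mul_sum, ← Finset.mul_sum, ← Finset.sum_filter]
    refine mul_le_mul_of_nonneg_left (add_le_add ?_ ?_) hX0.le
    · refine mul_le_mul_of_nonneg_left ?_ hℓ0
      have hinj : Set.InjOn (Subtype.val : nontrivialZeros f → ℂ)
          ↑(u₁.filter fun ρ : nontrivialZeros f ↦ (1 / 4 : ℝ) ≤ (ρ : ℂ).re) :=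
        fun a _ b _ h ↦ Subtype.ext h
      rw [← Finset.sum_image (f := fun ρ : ℂ ↦ m ρ * X ^ (ρ.re - 1)) hinj]
      refine Finset.sum_le_sum_of_subset_of_nonneg ?_ fun ρ _ _ ↦
        mul_nonneg (hm0 ρ) (Real.rpow_nonneg hX0.le _)
      intro z hz
      obtain ⟨ρ, hρ, rfl⟩ := Finset.mem_image.1 hz
      rw [Finset.mem_filter] at hρ ⊢
      rw [hu₁, Finset.mem_filter, Finset.mem_filter] at hρ
      exact ⟨(hmemFin _).2 ⟨ρ.2, hρ.1.2⟩, hρ.1.1.2, hρ.2⟩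
    · refine mul_le_mul_of_nonneg_left ?_ (by positivity)
      have hinj : Set.InjOn (Subtype.val : nontrivialZeros f → ℂ) ↑u₁ := fun a _ b _ h ↦ Subtype.ext h
      rw [← Finset.sum_image (f := fun ρ : ℂ ↦ m ρ) hinj]
      refine Finset.sum_le_sum_of_subset_of_nonneg ?_ fun ρ _ _ ↦ hm0 ρ
      intro z hz
      obtain ⟨ρ, hρ, rfl⟩ := Finset.mem_image.1 hz
      rw [hu₁, Finset.mem_filter, Finset.mem_filter] at hρ
      exact (hmemFin _).2 ⟨ρ.2, hρ.2⟩
  -- (b) the tail `|γ| > T₁`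
  have hpart2 : ∑ ρ ∈ u₂, m ρ * ‖fordLaplace (windowTest a b ε) (-(ρ : ℂ))‖ ≤
      X * ((2 * M / ε) * T₁ ^ (-((1 : ℝ) / 2)) * (W * (tailConst₁ * A + tailConst₂))) := by
    obtain ⟨hsumT, htail⟩ := tsum_tail_div_normSq_le hW hA hwin hT₁
    set G : nontrivialZeros f → ℝ := fun ρ ↦
      if T₁ ≤ |(ρ : ℂ).im| then (analyticOrderNatAt f (ρ : ℂ) : ℝ) / ‖(ρ : ℂ)‖ ^ 2 else 0 with hG
    have hG0 : ∀ ρ, 0 ≤ G ρ := fun ρ ↦ by rw [hG]; dsimp only; split_ifs <;> positivity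
    have hpt : ∀ ρ ∈ u₂, m ρ * ‖fordLaplace (windowTest a b ε) (-(ρ : ℂ))‖ ≤ X * (2 * M / ε) * G ρ := by
      intro ρ hρ
      rw [hu₂, Finset.mem_filter, not_le] at hρ
      have hγ : T₁ ≤ |(ρ : ℂ).im| := hρ.2.le
      rw [hG]; dsimp only; rw [if_pos hγ]
      have hβ1 := ρ.2.2.2
      have hXβ : X ^ ((ρ : ℂ).re - 1) ≤ 1 := Real.rpow_le_one_of_one_le_of_nonpos hX1 (by linarith)
      calc m ρ * ‖fordLaplace (windowTest a b ε) (-(ρ : ℂ))‖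
          ≤ m ρ * (X * X ^ ((ρ : ℂ).re - 1) * (2 * M / ε) / ‖(ρ : ℂ)‖ ^ 2) :=
            mul_le_mul_of_nonneg_left (hF₂ ρ) (hm0 _)
        _ ≤ m ρ * (X * 1 * (2 * M / ε) / ‖(ρ : ℂ)‖ ^ 2) := by
            refine mul_le_mul_of_nonneg_left (div_le_div_of_nonneg_right ?_ (by positivity)) (hm0 _)
            exact mul_le_mul_of_nonneg_right (mul_le_mul_of_nonneg_left hXβ hX0.le) (by positivity)
        _ = X * (2 * M / ε) * ((analyticOrderNatAt f (ρ : ℂ) : ℝ) / ‖(ρ : ℂ)‖ ^ 2) := by rw [hm]; ring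
    refine (Finset.sum_le_sum hpt).trans ?_
    rw [← Finset.mul_sum, mul_assoc X]
    refine mul_le_mul_of_nonneg_left ?_ hX0.le
    rw [mul_assoc]
    refine mul_le_mul_of_nonneg_left ((hsumT.sum_le_tsum u₂ fun ρ _ ↦ hG0 ρ).trans htail) (by positivity)
  have := add_le_add hpart1 hpart2
  refine this.trans (le_of_eq ?_)
  ring

end Literature.NumberTheory.LFunctions.EntireEF

end
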